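import Summits.BirchSwinnertonDyer.Rank1Residual.Additive.X4RankOneKimKatoConsistencyGap
import Summits.BirchSwinnertonDyer.Rank1Residual.Additive.CongruentPartnerBranchPAdicGrossZagierIff
import Summits.BirchSwinnertonDyer.Rank1Residual.Additive.SemistableTwistTowerThree
import Summits.BirchSwinnertonDyer.Rank1Residual.Additive.CensusX42BSD
import Summits.BirchSwinnertonDyer.Rank1Residual.Additive.CensusQ6CoeffValuation
import Summits.BirchSwinnertonDyer.Rank1Residual.AdditivePotMult.PotMultBudgetRankZeroEnds
import HarnessLib

/-!
# X4♯(G-ord) ∧ `r_an = 1` at INDEX `n₀`: the Kurihara `∂`-gap computed by the Kato/Delbourgo side on the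
# BUDGET rows — `∂^{(1)} − ∂^{(∞)} + v(Reg_p) + ord_p ∏c + ord_p ℓ = v_p(c₁(ϖB)) + 1 + 2·ord_p #E(ℚ)_tors`
# (cell `b2b-bsdres`, team n1011, seat p17 gen 2, PROPOSED row T-KK-BUD; the index-`n₀` twin of
# `X4RankOneKimKatoConsistencyGap.lean` (p254952) over n1011-p01's T-E3g `v₁`-identity
# `CongruentPartnerBranchPAdicGrossZagierIff.lean` (p257300) and n1011-p10 / p07's budget vocabulary;
# the kernel the KURREG register (§9 A3) requires before any claim on `B ≥ 2` rows is registered)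

HONEST FRAMING (cell `b2b-bsdres`, run/shared/lean/b2b/bsd-rank1-residual/, verbatim in every
file): the goal of the cell is to DELETE the COMBINATION-SHAPED residual classes of the
Birch–Swinnerton-Dyer formula for ALL analytic-rank `≤ 1` elliptic curves over `ℚ` — "full BSD
formula for every rank `≤ 1` curve in class `C`" assembled STRICTLY from published theorems — so
that the rank-`≤ 1` remainder becomes exactly the CONSTRUCTION-SHAPED classes, which are TYPED
(missing-input `Prop`s), NOT attempted. This is not "finishing BSD". Team n1011: prove what is
provable now; shrink each hard class to its core with data; no claim beyond stated classes;
research routes; census output = EVIDENCE / conjecture items, never a Literature fact; RESIDUAL-MAP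
marks change only by signed lines. X4 stays CONSTRUCTION-SHAPED; §I O7 / N10 stay as marked; nothing
here is booked. Theorems only (NO definition, NO Literature fact, NO `_holds`); every published input
(`hE73` = Kim's clause (6) AS PRINTED at `p ≥ 5`, flag `Kim2026-(6)-cyclic-reading`; `hKato` = Kato
17.4 (3) half-eigen reading), every conjecture (at `p = 3`: OUR `X4SharpThreeKimRankOnePartial`; Conj.
1.10 only in the `_of_tamagawaDefect` form) and every certificate (`BranchUnitCoeffAt W p b` = ONE unit
coefficient at index `b`, p10; `BudgetLeLambdaAt p W b`, p10 — census / partner records, EVIDENCE; the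
Kurihara witness `∂^{(1)} ≠ ∞`, EVIDENCE) is an explicit hypothesis. `#print axioms` standard.

COVERAGE (stated first, referee 1 proviso): per pair, `W/ℚ` globally minimal, `ClassX4Gord W p`,
`semistabilityIndex W p = 2`, `ρ̄_{E,p}` onto, `ord_{s=1} L(E,s) = 1`; a good-ordinary twist model
`C • V^{(p*)} = W` with newform `f` and period ratio `ϖ` of the parity of `(p−1)/2` and `c₁(ϖ·B) ≠ 0`
(`B` the `ω^{(p−1)/2}`-branch; the SIMPLE analytic zero); §1–§2 `p ≥ 5`, §3 `p = 3`. The Serre tower is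
DISCHARGED here (`ClassX4Gord.towerSurj_of_surj`, every odd `p`) — an upgrade over p254952 / p257102,
re-exported tower-free in §4 / FILE 2. NOT covered: the (M) budget rows (wait for p07-g3's T-E3gM FILE 2c; the
(M) index-1 rows are p257102), X3♯ rows (reducible image: no Kurihara side).

## What

p01's `v₁`-identity (every odd `p`, NO `5 ≤ p` / CM / non-anomalous binder): with the certificate at
index `b` and the budget `b ≤ λ`, for every admissible datum with `c₁(ϖB) ≠ 0` and every (B)-datum,
`ord_p #Ш(E) + v(Reg_p(E,Dh)) + ord_p ∏c + ord_p ℓ = v_p(c₁(ϖB)) + 1 + 2·ord_p #E(ℚ)_tors` (`ℓ ∣ p²`,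
`= 1` off anomalous). With Kim's clause (6) in rank one (`ord_p #Ш = ∂^{(1)} − ∂^{(∞)}`):

* §1 `ClassX4Gord.kuriharaGap_identity_rankOne_of_kim2026_of_katoHalf_of_coeffCert_of_budget_of_five_le`
  (`p ≥ 5`, NO conjecture): **`∂^{(1)} − ∂^{(∞)} + v(Reg_p) + ord_p ∏c + ord_p ℓ = v₁ + 1 + 2·ord_p #tors`**;
  `…_of_tamagawaDefect_…` (+ Conj. 1.10: `∂^{(1)} + v(Reg_p) + ord_p ℓ = v₁ + 1`).
* §2 index `1`, budget FREE (`budgetLeLambdaAt_of_le_mordellWeilRank`, rank `= 1`): only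
  `‖c₁(ϖB)‖ = 1` at index `1` (`BranchUnitCoeffAt W p 1`; no constant-term clause, no tower binder) ⟹
  the p254952 §1 identity — `…_of_coeffCert_one_of_five_le`.
* §3 `p = 3` (modulo OUR conjecture): `ClassX4Gord.kuriharaGap_identity_three_rankOne_of_kimPartial_of_
  katoHalf_of_coeffCert_of_budget`.
* §1b CENSUS-LITERAL form: the `v1` column as ctyper-1's record `CensusQ6.GordCoeffValAt W p 1 v₁` (twist
  datum DISCHARGED) — `…_of_gordCoeffValAt_of_budget_of_five_le`.
* §4 tower-free re-export of p254952 §1 (`…'`); the (M) one is in FILE 2.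

KURREG reading (EVIDENCE design, nothing registered here): on the `B ≥ 2` rows (forced-blind for an
index-1 certificate; 198 of the 337 K1 rows, 1 982 of the 2 955 K1-M rows — §9 A3) the scored relation is
§1 with the column `v1 = v_p(c₁(ϖB))` (census-ctyper1's `GordCoeffValAt W p 1 v₁`), the certificate at
index `n₀` and the budget `n₀ ≤ λ` (r2's R1-BUDGET `m(B)`).

References: [Kim2022StructureSelmer] Thm. 1.9 (6), Conj. 1.10 (PDF p. 8); [Kato2004Asterisque] Thm. 17.4
(3) (p. 273); [Delbourgo2002] Thm. (B) (p. 40), Hypothesis (p. 39); [GreenbergLNM1716] §3 Lemma 3.1;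
[EmertonPollackWeston2006] Thm. 3.3.3 (budget shape). Cell files cells/n1011/OWNERS.md (T-KK-BUD),
cells/n1011/PREDICTIONS-KURREG.md §9 A3.
-/

noncomputable section

open scoped Classical MatrixGroups ModularForm NumberField

namespace Summit.BirchSwinnertonDyer.Rank1Residual.Additive

open CongruenceSubgroup WeierstrassCurve NumberField Literature.NumberTheory.EllipticCurves
  Literature.NumberTheory.EllipticCurves.ModularForms
  Literature.NumberTheory.EllipticCurves.Rank1Residual
  Literature.NumberTheory.EllipticCurves.Rank1Residual.Typed
  Literature.NumberTheory.EllipticCurves.Delbourgo2002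
  Literature.NumberTheory.GaloisRepresentations Summit.BirchSwinnertonDyer.Rank1Residual.AdditivePotMult
  Summit.BirchSwinnertonDyer.Rank1Residual.X1.MuLambda
  Summit.BirchSwinnertonDyer.Rank1Residual.X1.RankOneParitySqueeze
  IsDedekindDomain

/-! ## §1 `p ≥ 5`, index `b`: NO conjecture, tower discharged -/

section FiveLe

variable {W : WeierstrassCurve ℚ} [W.IsElliptic] [W.IsGloballyMinimal] {p : ℕ} [hp : Fact p.Prime]

/-- **X4♯(G-ord) ∩ `I₀*` ∩ {`ρ̄` onto}, `p ≥ 5`, `r_an = 1`, certificate at index `b` + budget `b ≤ λ`,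
admissible datum with `c₁(ϖB) ≠ 0`, (B)-datum, parametrisation datum, ONE non-zero Kurihara number:
`∂^{(1)}(δ̃) − ∂^{(∞)}(δ̃) + v(Reg_p(E,Dh)) + ord_p ∏c + ord_p ℓ = v_p(c₁(ϖB)) + 1 + 2·ord_p #E(ℚ)_tors`**
(`ℓ ∣ p²`, `ℓ = 1` off the anomalous rows) — modulo the PUBLISHED facts `hE73`, `hKato`, GZK,
modularity and the certificates; NO conjecture; the Serre tower DISCHARGED (`ClassX4Gord.towerSurj_of_surj`).
Per pair; nothing booked. [cite: Kim2022StructureSelmer, Thm. 1.9 (6) (PDF p. 8)]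
[cite: Kato2004Asterisque, Thm. 17.4 (3) (p. 273)] [cite: Delbourgo2002, Theorem (B) (p. 40)]
[cite: GreenbergLNM1716, §3 Lemma 3.1] -/
theorem ClassX4Gord.kuriharaGap_identity_rankOne_of_kim2026_of_katoHalf_of_coeffCert_of_budget_of_five_le
    (hE73 : Kim2026.kuriharaPartial_vanishingOrder_eq_padicValNat_sha_add_partialInfty_of_maninConstant)
    (hKato : Wuthrich2014.kato_halfEigenCharIdeal_dvd_cyclotomicPrime_of_surjective)
    (hGZK : rank_eq_analyticRank_of_analyticRank_le_one) (hmod : hasEntireLFunction_rat)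
    (hX : ClassX4Gord W p) (hp5 : 5 ≤ p) (he : semistabilityIndex W p = 2) (hsurj : Surj W p)
    (hr : W.analyticRank = 1) {b : ℕ} (hcert : BranchUnitCoeffAt W p b) (hbud : BudgetLeLambdaAt p W b)
    (V : WeierstrassCurve ℚ) [V.IsElliptic] [V.IsGloballyMinimal] (C : VariableChange ℚ)
    (hC : C • V.quadraticTwist ((-1 : ℚ) ^ (p / 2) * p) = W) (hV : GoodOrd V p)
    {N₁ : ℕ} [NeZero N₁] {f : CuspForm (Gamma0 N₁) 2} (hf : IsNewformOf V f) (ϖ : ℚ)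
    (hϖ : if Even (p / 2) then (ϖ : ℝ) * V.realPeriodRat = plusPeriod f
      else (ϖ : ℝ) * V.imaginaryPeriodRat = minusPeriod f)
    (hne₁ : PowerSeries.coeff 1 (PowerSeries.C (ϖ : ℚ_[p]) *
      (if Even (p / 2) then padicLFunctionBranch f ((unitRoot V p : ℤ_[p]) : ℚ_[p]) (p / 2)
        else padicLFunctionMinusBranch f ((unitRoot V p : ℤ_[p]) : ℚ_[p]) (p / 2))) ≠ 0)
    {Dh : PAdicHeightData W p} (hB : LeadingTermClauses W p Dh)
    {N : ℕ} [NeZero N] (D : ModularParametrizationData W N) (hc : ¬ (p : ℤ) ∣ D.maninConstant)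
    (hper : ∃ u : ℚ, ‖(u : ℚ_[p])‖ = 1 ∧ W.realPeriodRat = u * plusPeriod D.f)
    (hne : kuriharaPartial W p D.f 1 ≠ ⊤) :
    ∃ ℓ : ℕ, ℓ ∣ p ^ 2 ∧ (ReductionNonAnomalous W p → ℓ = 1) ∧
      ∃ m d : ℕ, kuriharaPartial W p D.f 1 = m ∧ kuriharaPartialInfty W p D.f = d ∧
        (m : ℤ) - d + (padicRegulator Dh).valuation + padicValNat p W.tamagawaProduct + padicValNat p ℓ =
          (PowerSeries.coeff 1 (PowerSeries.C (ϖ : ℚ_[p]) *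
              (if Even (p / 2) then padicLFunctionBranch f ((unitRoot V p : ℤ_[p]) : ℚ_[p]) (p / 2)
                else padicLFunctionMinusBranch f ((unitRoot V p : ℤ_[p]) : ℚ_[p]) (p / 2)))).valuation +
            1 + 2 * padicValNat p W.torsionOrder := by
  have hr1 : W.analyticRank ≤ 1 := by rw [hr]
  have hL : W.entireLFunction 1 = 0 := by
    by_contra hne'
    have h0 := (W.analyticRank_eq_zero_iff_holds (hmod W)).mpr hne'
    omega
  have hfin : Finite W.sha := (hGZK W hr1).2
  have hid := padicValNat_shaOrder_add_partialInfty_eq_of_kimRankOnePartialAt W p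
    (kimRankOnePartialAt_of_kim2026_of_five_le W p hE73 hp5) hsurj (hX.towerSurj_of_surj he hsurj) hL hr
    hfin D hc hper hne
  obtain ⟨-, ℓ, hℓ, hℓ1, hidK⟩ :=
    hX.schneider_and_padicVal_identity_rankOne_of_katoHalf_of_coeffCert_of_budget hKato hGZK he hsurj hr
      hcert hbud V C hC hV hf ϖ hϖ hne₁ hB
  exact ⟨ℓ, hℓ, hℓ1, kuriharaGap_identity_of_shaOrder_identities W p D.f hid hne hidK⟩

/-- **With Kim's Conjecture 1.10 at the pair** (`hT : ∂^{(∞)} = ord_p ∏c`), `p ≥ 5`, index `b`: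
**`∂^{(1)}(δ̃) + v(Reg_p(E,Dh)) + ord_p ℓ = v_p(c₁(ϖB)) + 1`** (`p ∤ #E(ℚ)_tors`: `E[p]` irreducible). A
BSD-free falsification handle for Conj. 1.10 on the budget rows. Per pair; nothing booked.
[cite: Kim2022StructureSelmer, Thm. 1.9 (6), Conj. 1.10 (PDF p. 8)] [cite: Kato2004Asterisque, Thm. 17.4 (3) (p. 273)]
[cite: Delbourgo2002, Theorem (B) (p. 40)] -/
theorem ClassX4Gord.kuriharaPartial_one_identity_rankOne_of_kim2026_of_tamagawaDefect_of_coeffCert_of_budget_of_five_le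
    (hE73 : Kim2026.kuriharaPartial_vanishingOrder_eq_padicValNat_sha_add_partialInfty_of_maninConstant)
    (hKato : Wuthrich2014.kato_halfEigenCharIdeal_dvd_cyclotomicPrime_of_surjective)
    (hGZK : rank_eq_analyticRank_of_analyticRank_le_one) (hmod : hasEntireLFunction_rat)
    (hX : ClassX4Gord W p) (hp5 : 5 ≤ p) (he : semistabilityIndex W p = 2) (hsurj : Surj W p)
    (hr : W.analyticRank = 1) {b : ℕ} (hcert : BranchUnitCoeffAt W p b) (hbud : BudgetLeLambdaAt p W b)
    (V : WeierstrassCurve ℚ) [V.IsElliptic] [V.IsGloballyMinimal] (C : VariableChange ℚ)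
    (hC : C • V.quadraticTwist ((-1 : ℚ) ^ (p / 2) * p) = W) (hV : GoodOrd V p)
    {N₁ : ℕ} [NeZero N₁] {f : CuspForm (Gamma0 N₁) 2} (hf : IsNewformOf V f) (ϖ : ℚ)
    (hϖ : if Even (p / 2) then (ϖ : ℝ) * V.realPeriodRat = plusPeriod f
      else (ϖ : ℝ) * V.imaginaryPeriodRat = minusPeriod f)
    (hne₁ : PowerSeries.coeff 1 (PowerSeries.C (ϖ : ℚ_[p]) *
      (if Even (p / 2) then padicLFunctionBranch f ((unitRoot V p : ℤ_[p]) : ℚ_[p]) (p / 2)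
        else padicLFunctionMinusBranch f ((unitRoot V p : ℤ_[p]) : ℚ_[p]) (p / 2))) ≠ 0)
    {Dh : PAdicHeightData W p} (hB : LeadingTermClauses W p Dh)
    {N : ℕ} [NeZero N] (D : ModularParametrizationData W N) (hc : ¬ (p : ℤ) ∣ D.maninConstant)
    (hper : ∃ u : ℚ, ‖(u : ℚ_[p])‖ = 1 ∧ W.realPeriodRat = u * plusPeriod D.f)
    (hne : kuriharaPartial W p D.f 1 ≠ ⊤) (hT : X4.KimTamagawaDefectAt W p D.f) :
    ∃ ℓ : ℕ, ℓ ∣ p ^ 2 ∧ (ReductionNonAnomalous W p → ℓ = 1) ∧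
      ∃ m : ℕ, kuriharaPartial W p D.f 1 = m ∧
        (m : ℤ) + (padicRegulator Dh).valuation + padicValNat p ℓ =
          (PowerSeries.coeff 1 (PowerSeries.C (ϖ : ℚ_[p]) *
              (if Even (p / 2) then padicLFunctionBranch f ((unitRoot V p : ℤ_[p]) : ℚ_[p]) (p / 2)
                else padicLFunctionMinusBranch f ((unitRoot V p : ℤ_[p]) : ℚ_[p]) (p / 2)))).valuation +
            1 := by
  obtain ⟨ℓ, hℓ, hℓ1, m, d, hm, hd, hid⟩ :=
    hX.kuriharaGap_identity_rankOne_of_kim2026_of_katoHalf_of_coeffCert_of_budget_of_five_le hE73 hKato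
      hGZK hmod hp5 he hsurj hr hcert hbud V C hC hV hf ϖ hϖ hne₁ hB D hc hper hne
  have htors0 : padicValNat p W.torsionOrder = 0 :=
    padicValNat_torsionOrder_eq_zero_of_irreducible W p hX.1.2.2
  unfold X4.KimTamagawaDefectAt at hT
  have hdT : (d : ℕ∞) = (padicValNat p W.tamagawaProduct : ℕ∞) := hd.symm.trans hT
  have hdT' : d = padicValNat p W.tamagawaProduct := by exact_mod_cast hdT
  refine ⟨ℓ, hℓ, hℓ1, m, hm, ?_⟩
  rw [htors0, hdT'] at hid
  simp only [Nat.cast_zero, mul_zero, add_zero] at hid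
  linarith

/-- **CENSUS-LITERAL form of §1** (the KURREG row shape): X4♯(G-ord) ∩ `I₀*` ∩ {`ρ̄` onto}, `p ≥ 5`,
`r_an = 1`, certificate at index `n₀` (`BranchUnitCoeffAt W p n₀`, from the Q6 record by census-ctyper1's
`branchUnitCoeffAt_of_gord[Odd]FirstUnitIndexAt`) + budget `n₀ ≤ λ` + the VALUATION RECORD at index `1`
`CensusQ6.GordCoeffValAt W p 1 v₁` (column `v1`; census-ctyper1) — the twist datum is DISCHARGED
(`ClassX4Gord.exists_goodOrd_pStar_twist_model`, `hmodD`): **`∂^{(1)} − ∂^{(∞)} + v(Reg_p(E,Dh)) +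
ord_p ∏c + ord_p ℓ = v₁ + 1 + 2·ord_p #E(ℚ)_tors`** with `v₁ ∈ ℤ` a census integer. NO conjecture; per
pair; nothing booked. [cite: Kim2022StructureSelmer, Thm. 1.9 (6) (PDF p. 8)]
[cite: Kato2004Asterisque, Thm. 17.4 (3) (p. 273)] [cite: Delbourgo2002, Theorem (B) (p. 40)]
[cite: MazurTateTeitelbaum1986Invent, §I.13 (the record; nothing asserted)] -/
theorem ClassX4Gord.kuriharaGap_identity_rankOne_of_kim2026_of_katoHalf_of_gordCoeffValAt_of_budget_of_five_le
    (hE73 : Kim2026.kuriharaPartial_vanishingOrder_eq_padicValNat_sha_add_partialInfty_of_maninConstant)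
    (hKato : Wuthrich2014.kato_halfEigenCharIdeal_dvd_cyclotomicPrime_of_surjective)
    (hmodD : nonempty_modularParametrizationData)
    (hGZK : rank_eq_analyticRank_of_analyticRank_le_one) (hmod : hasEntireLFunction_rat)
    (hX : ClassX4Gord W p) (hp5 : 5 ≤ p) (he : semistabilityIndex W p = 2) (hsurj : Surj W p)
    (hr : W.analyticRank = 1) {n₀ : ℕ} (hcert : BranchUnitCoeffAt W p n₀) (hbud : BudgetLeLambdaAt p W n₀)
    {v₁ : ℤ} (hv1 : CensusQ6.GordCoeffValAt W p 1 v₁)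
    {Dh : PAdicHeightData W p} (hB : LeadingTermClauses W p Dh)
    {N : ℕ} [NeZero N] (D : ModularParametrizationData W N) (hc : ¬ (p : ℤ) ∣ D.maninConstant)
    (hper : ∃ u : ℚ, ‖(u : ℚ_[p])‖ = 1 ∧ W.realPeriodRat = u * plusPeriod D.f)
    (hne : kuriharaPartial W p D.f 1 ≠ ⊤) :
    ∃ ℓ : ℕ, ℓ ∣ p ^ 2 ∧ (ReductionNonAnomalous W p → ℓ = 1) ∧
      ∃ m d : ℕ, kuriharaPartial W p D.f 1 = m ∧ kuriharaPartialInfty W p D.f = d ∧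
        (m : ℤ) - d + (padicRegulator Dh).valuation + padicValNat p W.tamagawaProduct + padicValNat p ℓ =
          v₁ + 1 + 2 * padicValNat p W.torsionOrder := by
  obtain ⟨V, iV, iVm, C, hV, hC⟩ := hX.exists_goodOrd_pStar_twist_model W p he
  haveI : NeZero (V.conductorNorm ℤ) := ⟨(V.conductorNorm_pos_holds).ne'⟩
  obtain ⟨Dm⟩ := hmodD V
  obtain ⟨ϖ, hϖ⟩ := exists_periodRatio_parity (p := p) V Dm
  have hord : IsOrdinaryAt V p :=
    isOrdinaryAt_of_goodOrd_or_mult_of_model_twist W V (pStar_ne_zero p) ⟨C, hC⟩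
      (padicValRat_j_nonneg_of_typeGOrd W p hX.typeGOrd) (Or.inl hV)
  obtain ⟨hne₁, hval⟩ := hv1.coeff_ne_zero_and_valuation_eq V C hC hord Dm.f Dm.isNewformOf ϖ hϖ
  obtain ⟨ℓ, hℓ, hℓ1, m, d, hm, hd, hid⟩ :=
    hX.kuriharaGap_identity_rankOne_of_kim2026_of_katoHalf_of_coeffCert_of_budget_of_five_le hE73 hKato
      hGZK hmod hp5 he hsurj hr hcert hbud V C hC hV Dm.isNewformOf ϖ hϖ hne₁ hB D hc hper hne
  refine ⟨ℓ, hℓ, hℓ1, m, d, hm, hd, ?_⟩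
  rw [hval] at hid
  exact hid

/-! ## §2 Index `1`: the budget is FREE (`rank = 1`), only `‖c₁(ϖB)‖ = 1` is needed -/

/-- **X4♯(G-ord) ∩ `I₀*` ∩ {`ρ̄` onto}, `p ≥ 5`, `r_an = 1`, ONE `p`-adic unit at index `1`
(`BranchUnitCoeffAt W p 1`: `‖c₁(ϖB)‖ = 1` for every admissible datum — NO constant-term clause, NO
tower binder; the budget `1 ≤ λ` is FREE from `rank = 1` by p07's `budgetLeLambdaAt_of_le_mordellWeilRank`):
`∂^{(1)} − ∂^{(∞)} + v(Reg_p(E,Dh)) + ord_p ∏c + ord_p ℓ = 1 + 2·ord_p #E(ℚ)_tors`** — the tower-free,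
`c₀`-free UPGRADE of p254952 §1 (`v₁ = 0` because `c₁` is a unit). The twist datum is DISCHARGED
(`ClassX4Gord.exists_goodOrd_pStar_twist_model`, `hmodD`, the period ratio of the parity).
[cite: Kim2022StructureSelmer, Thm. 1.9 (6) (PDF p. 8)] [cite: Kato2004Asterisque, Thm. 17.4 (3) (p. 273)]
[cite: Delbourgo2002, Theorem (B) (p. 40)] -/
theorem ClassX4Gord.kuriharaGap_identity_rankOne_of_kim2026_of_katoHalf_of_coeffCert_one_of_five_le
    (hE73 : Kim2026.kuriharaPartial_vanishingOrder_eq_padicValNat_sha_add_partialInfty_of_maninConstant)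
    (hKato : Wuthrich2014.kato_halfEigenCharIdeal_dvd_cyclotomicPrime_of_surjective)
    (hmodD : nonempty_modularParametrizationData)
    (hGZK : rank_eq_analyticRank_of_analyticRank_le_one) (hmod : hasEntireLFunction_rat)
    (hX : ClassX4Gord W p) (hp5 : 5 ≤ p) (he : semistabilityIndex W p = 2) (hsurj : Surj W p)
    (hr : W.analyticRank = 1) (hcert : BranchUnitCoeffAt W p 1)
    {Dh : PAdicHeightData W p} (hB : LeadingTermClauses W p Dh)
    {N : ℕ} [NeZero N] (D : ModularParametrizationData W N) (hc : ¬ (p : ℤ) ∣ D.maninConstant)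
    (hper : ∃ u : ℚ, ‖(u : ℚ_[p])‖ = 1 ∧ W.realPeriodRat = u * plusPeriod D.f)
    (hne : kuriharaPartial W p D.f 1 ≠ ⊤) :
    ∃ ℓ : ℕ, ℓ ∣ p ^ 2 ∧ (ReductionNonAnomalous W p → ℓ = 1) ∧
      ∃ m d : ℕ, kuriharaPartial W p D.f 1 = m ∧ kuriharaPartialInfty W p D.f = d ∧
        (m : ℤ) - d + (padicRegulator Dh).valuation + padicValNat p W.tamagawaProduct + padicValNat p ℓ =
          1 + 2 * padicValNat p W.torsionOrder := by
  -- the twist datum, discharged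
  obtain ⟨V, iV, iVm, C, hV, hC⟩ := hX.exists_goodOrd_pStar_twist_model W p he
  haveI : NeZero (V.conductorNorm ℤ) := ⟨(V.conductorNorm_pos_holds).ne'⟩
  obtain ⟨Dm⟩ := hmodD V
  obtain ⟨ϖ, hϖ⟩ := exists_periodRatio_parity (p := p) V Dm
  have hord : IsOrdinaryAt V p :=
    isOrdinaryAt_of_goodOrd_or_mult_of_model_twist W V (pStar_ne_zero p) ⟨C, hC⟩
      (padicValRat_j_nonneg_of_typeGOrd W p hX.typeGOrd) (Or.inl hV)
  -- the unit at index 1: `c₁ ≠ 0` and `v(c₁) = 0`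
  obtain ⟨hne₁, hv₁⟩ := CensusX42.valuation_eq_zero_of_norm_eq_one (p := p)
    (hcert V C hC hord Dm.f Dm.isNewformOf ϖ hϖ)
  -- the budget `1 ≤ λ` is free in rank one
  obtain ⟨hmw, -⟩ := hGZK W (by rw [hr])
  have hbud : BudgetLeLambdaAt p W 1 :=
    budgetLeLambdaAt_of_le_mordellWeilRank (by rw [hmw, hr])
  obtain ⟨ℓ, hℓ, hℓ1, m, d, hm, hd, hid⟩ :=
    hX.kuriharaGap_identity_rankOne_of_kim2026_of_katoHalf_of_coeffCert_of_budget_of_five_le hE73 hKato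
      hGZK hmod hp5 he hsurj hr hcert hbud V C hC hV Dm.isNewformOf ϖ hϖ hne₁ hB D hc hper hne
  refine ⟨ℓ, hℓ, hℓ1, m, d, hm, hd, ?_⟩
  rw [hv₁] at hid
  linarith

end FiveLe

/-! ## §3 `p = 3`, index `b`: modulo OUR `∂`-clause conjecture (p01's `v₁`-identity is `p`-general) -/

section Three

variable {W : WeierstrassCurve ℚ} [W.IsElliptic] [W.IsGloballyMinimal] [hp : Fact (Nat.Prime 3)]

/-- **X4♯(G-ord)@3 ∩ {`ρ̄₃` onto}, `r_an = 1`, certificate at index `b` + budget at `3`, admissible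
datum with `c₁(ϖB) ≠ 0`, (B)-datum, parametrisation datum, ONE non-zero Kurihara number:
`∂^{(1)} − ∂^{(∞)} + v(Reg₃(E,Dh)) + ord₃ ∏c + ord₃ ℓ = v₃(c₁(ϖB)) + 1 + 2·ord₃ #E(ℚ)_tors`** — modulo OUR
conjecture `X4SharpThreeKimRankOnePartial` + Kato 17.4 (3) + GZK + modularity + the certificates; NO
Conj. 1.10; tower by `ClassX4Gord.towerSurj_of_surj`; the defect `e = 2` is AUTOMATIC at `3`
(`semistabilityIndex_eq_two_of_typeG_three`, no `he` binder). Per pair; nothing booked.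
[cite: Kim2022StructureSelmer, Thm. 1.9 (6) (PDF p. 8)] [cite: Kato2004Asterisque, Thm. 17.4 (3) (p. 273)]
[cite: Delbourgo2002, Theorem (B) (p. 40)] -/
theorem ClassX4Gord.kuriharaGap_identity_three_rankOne_of_kimPartial_of_katoHalf_of_coeffCert_of_budget
    (h3 : X4SharpThreeKimRankOnePartial)
    (hKato : Wuthrich2014.kato_halfEigenCharIdeal_dvd_cyclotomicPrime_of_surjective)
    (hGZK : rank_eq_analyticRank_of_analyticRank_le_one) (hmod : hasEntireLFunction_rat)
    (hX : ClassX4Gord W 3) (hsurj : Surj W 3)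
    (hr : W.analyticRank = 1) {b : ℕ} (hcert : BranchUnitCoeffAt W 3 b) (hbud : BudgetLeLambdaAt 3 W b)
    (V : WeierstrassCurve ℚ) [V.IsElliptic] [V.IsGloballyMinimal] (C : VariableChange ℚ)
    (hC : C • V.quadraticTwist ((-1 : ℚ) ^ (3 / 2) * (3 : ℕ)) = W) (hV : GoodOrd V 3)
    {N₁ : ℕ} [NeZero N₁] {f : CuspForm (Gamma0 N₁) 2} (hf : IsNewformOf V f) (ϖ : ℚ)
    (hϖ : if Even (3 / 2) then (ϖ : ℝ) * V.realPeriodRat = plusPeriod f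
      else (ϖ : ℝ) * V.imaginaryPeriodRat = minusPeriod f)
    (hne₁ : PowerSeries.coeff 1 (PowerSeries.C (ϖ : ℚ_[3]) *
      (if Even (3 / 2) then padicLFunctionBranch f ((unitRoot V 3 : ℤ_[3]) : ℚ_[3]) (3 / 2)
        else padicLFunctionMinusBranch f ((unitRoot V 3 : ℤ_[3]) : ℚ_[3]) (3 / 2))) ≠ 0)
    {Dh : PAdicHeightData W 3} (hB : LeadingTermClauses W 3 Dh)
    {N : ℕ} [NeZero N] (D : ModularParametrizationData W N) (hc : ¬ (3 : ℤ) ∣ D.maninConstant)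
    (hper : ∃ u : ℚ, ‖(u : ℚ_[3])‖ = 1 ∧ W.realPeriodRat = u * plusPeriod D.f)
    (hne : kuriharaPartial W 3 D.f 1 ≠ ⊤) :
    ∃ ℓ : ℕ, ℓ ∣ 3 ^ 2 ∧ (ReductionNonAnomalous W 3 → ℓ = 1) ∧
      ∃ m d : ℕ, kuriharaPartial W 3 D.f 1 = m ∧ kuriharaPartialInfty W 3 D.f = d ∧
        (m : ℤ) - d + (padicRegulator Dh).valuation + padicValNat 3 W.tamagawaProduct + padicValNat 3 ℓ =
          (PowerSeries.coeff 1 (PowerSeries.C (ϖ : ℚ_[3]) *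
              (if Even (3 / 2) then padicLFunctionBranch f ((unitRoot V 3 : ℤ_[3]) : ℚ_[3]) (3 / 2)
                else padicLFunctionMinusBranch f ((unitRoot V 3 : ℤ_[3]) : ℚ_[3]) (3 / 2)))).valuation +
            1 + 2 * padicValNat 3 W.torsionOrder := by
  have hr1 : W.analyticRank ≤ 1 := by rw [hr]
  have hL : W.entireLFunction 1 = 0 := by
    by_contra hne'
    have h0 := (W.analyticRank_eq_zero_iff_holds (hmod W)).mpr hne'
    omega
  have hfin : Finite W.sha := (hGZK W hr1).2
  -- at `3` the defect is `2` automatically on a (G)-row (p14's `semistabilityIndex_eq_two_of_typeG_three`)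
  have he : semistabilityIndex W 3 = 2 :=
    semistabilityIndex_eq_two_of_typeG_three W hX.typeGOrd.typeG hX.addv.2
  have hid := padicValNat_shaOrder_add_partialInfty_eq_of_kimRankOnePartialAt W 3
    (kimRankOnePartialAt_three_of_classX4 W h3 hX.1) hsurj (hX.towerSurj_of_surj he hsurj) hL hr hfin D
    (by exact_mod_cast hc) hper hne
  obtain ⟨-, ℓ, hℓ, hℓ1, hidK⟩ :=
    hX.schneider_and_padicVal_identity_rankOne_of_katoHalf_of_coeffCert_of_budget hKato hGZK he hsurj hr
      hcert hbud V C hC hV hf ϖ hϖ hne₁ hB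
  exact ⟨ℓ, hℓ, hℓ1, kuriharaGap_identity_of_shaOrder_identities W 3 D.f hid hne hidK⟩

end Three

/-! ## §4 Tower-free re-export of p254952 §1 -/

section TowerFree

variable {W : WeierstrassCurve ℚ} [W.IsElliptic] [W.IsGloballyMinimal] {p : ℕ} [hp : Fact p.Prime]

/-- **p254952 §1 without the tower binder** (X4♯(G-ord), `e = 2`, `p ≥ 5`, surj, `r_an = 1`, strong
certificate `BranchUnitCertificateAt`): the tower of `E` comes from surj(p) by
`ClassX4Gord.towerSurj_of_surj`. [cite: Kim2022StructureSelmer, Thm. 1.9 (6) (PDF p. 8)]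
[cite: Kato2004Asterisque, Thm. 17.4 (3) (p. 273)] [cite: Delbourgo2002, Theorem (B) (p. 40)] -/
theorem ClassX4Gord.kuriharaGap_identity_rankOne_of_kim2026_of_katoHalf_of_cert_of_five_le'
    (hE73 : Kim2026.kuriharaPartial_vanishingOrder_eq_padicValNat_sha_add_partialInfty_of_maninConstant)
    (hKato : Wuthrich2014.kato_halfEigenCharIdeal_dvd_cyclotomicPrime_of_surjective)
    (hmodD : nonempty_modularParametrizationData)
    (hGZK : rank_eq_analyticRank_of_analyticRank_le_one) (hmod : hasEntireLFunction_rat)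
    (hX : ClassX4Gord W p) (hp5 : 5 ≤ p) (he : semistabilityIndex W p = 2) (hsurj : Surj W p)
    (hr : W.analyticRank = 1) (hcert : BranchUnitCertificateAt W p)
    {Dh : PAdicHeightData W p} (hB : LeadingTermClauses W p Dh)
    {N : ℕ} [NeZero N] (D : ModularParametrizationData W N) (hc : ¬ (p : ℤ) ∣ D.maninConstant)
    (hper : ∃ u : ℚ, ‖(u : ℚ_[p])‖ = 1 ∧ W.realPeriodRat = u * plusPeriod D.f)
    (hne : kuriharaPartial W p D.f 1 ≠ ⊤) :
    ∃ ℓ : ℕ, ℓ ∣ p ^ 2 ∧ (ReductionNonAnomalous W p → ℓ = 1) ∧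
      ∃ m d : ℕ, kuriharaPartial W p D.f 1 = m ∧ kuriharaPartialInfty W p D.f = d ∧
        (m : ℤ) - d + (padicRegulator Dh).valuation + padicValNat p W.tamagawaProduct + padicValNat p ℓ =
          1 + 2 * padicValNat p W.torsionOrder :=
  hX.kuriharaGap_identity_rankOne_of_kim2026_of_katoHalf_of_cert_of_five_le hE73 hKato hmodD hGZK hmod hp5
    he hsurj (hX.towerSurj_of_surj he hsurj) hr hcert hB D hc hper hne

end TowerFree

end Summit.BirchSwinnertonDyer.Rank1Residual.Additive


end
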